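import Summits.ValiantsHypothesis.ValiantsHypothesis.Theorems.KPlusLogSqLawDiagonalDesign
import Summits.ValiantsHypothesis.ValiantsHypothesis.Theorems.LacunarySymmetroidMatrixDescartesDegreeCeiling
import Summits.ValiantsHypothesis.ValiantsHypothesis.Theorems.LacunarySymmetroidMatrixDescartesLowRankSector
import Summits.ValiantsHypothesis.ValiantsHypothesis.Theorems.LacunarySymmetroidTwoTermSector

/-!
# Route «KPlusLogSqLaw» — `Lifting` VERBATIM on three STRUCTURE SECTORS, all formats: bounded-height supports,
# affine-image supports (every arithmetic progression), and low-rank letters around one free letter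
# (toward crux `Lifting`, stmt-ValiantsHypothesis-19772; helper, seat val-sym-lift-p2)

HONEST FRAMING.  Object-search cell `pub-symmetroid`, Conjecture-B route `KPlusLogSqLaw`.  The crux `Lifting` — «a tropical row
bound `n` at format `(m, K)` gives the real row bound `2^{CK}·(n+1)` for EVERY real symmetric pencil of that format» — is an OPEN
conjecture and is NOT claimed; its fat-regime stub `stub_liftFat` (this seat's docket) is, in the window `2^C·K < m ≤ 2^{√K}`,
Conjecture B itself on fat formats (tree `…KPlusLogSqLawLiftingFatLocation`, `…LiftingDescartesMechanismFat`).  This file maps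
WHERE the inequality of `Lifting` can fail by proving it VERBATIM, for ALL `(m, K, n)`, on three classes of pencils on which the
cell owns a real bound that is LINEAR in the size (so Conjecture B is known there too — these are HELPER sectors in the sense
of the desk's R1348, not witness rungs; they exercise no lifting mechanism):

* HEIGHT SECTOR (`card_roots_le_of_height`, `lifting_boundedHeight`; constant written `c` in the statements): supports of height `max d ≤ D·(K−1)` give
  `Z ≤ D·(n+1)` — degree ceiling `Z ≤ m·max d` (tree `card_roots_det_pencil_le_degree`) against the tropical floor
  `m(K−1) ≤ n` (tree `DiagK.le_of_tropRootLawAt`); with `D = 2^{CK}` this is `Lifting`'s inequality with constant `C`.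
* AFFINE-IMAGE SECTOR (`det_pencil_affine`, `card_roots_toFinset_comp_X_pow_le`, `card_roots_affineSupport`,
  `lifting_affineSupport`, `lifting_apSupport`): supports `d = a + g·e` (`g ≥ 1`) with `max e ≤ H·(K−1)` give
  `Z ≤ (2H+1)·(n+1)` — the determinant is `X^{ma}·q(X^g)` with `q` the determinant of the COMPRESSED pencil on `e`, and
  the fibres of `x ↦ x^g` on `ℝ` have at most two points (tree `lacunarySymmetroid_card_le_two_of_pow_eq`); every
  ARITHMETIC-PROGRESSION support (`e l = l`, any start `a`, any gap `g`) gets `Z ≤ 3·(n+1) ≤ 2^{2K}·(n+1)`.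
* LOW-RANK SECTOR (`card_roots_lowRank_le`, `lifting_lowRankSector`): if all letters but one have rank `< 2^c` (`c ≥ 1`), then
  `Z ≤ 2^{cK} − 1` for EVERY size and support (tree `lowRankCeiling_uniform` for the pencil and its reflection, `stub_negRoots`),
  hence `Z ≤ 2^{cK}·(n+1)` with NO tropical input; rank-one letters around one arbitrary letter: `C = 1`.

So a failure of `Lifting` (or of B) needs, simultaneously: a support of height `> 2^{CK}(K−1)` that is not the affine image of a
support of height `≤ 2^{CK−1}(K−1)`, and at least two letters of rank `≥ 2^C` — complementing the FORMAT cones of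
`…LiftingDescartesZone` (`m ≤ cK`) and the PENCIL sectors of `…LiftingPencilSectors` (commuting, span-two).  None of the three
needs symmetry of the letters.  Nothing here bears on `TropicalB`, `KPlusLogSqLaw` in its window, `MatrixDescartes`
(stmt-ValiantsHypothesis-18050), a Door-A numeral, or `VP ≠ VNP`. [folklore]
-/

-- `Summit.ValiantsHypothesis.ValiantsHypothesis.…` repeats a component by the D-0017 layout
-- (single-conjunct summit), which the `dupNamespace` linter flags; the name is mandated.
set_option linter.dupNamespace false
set_option autoImplicit false

namespace Summit.ValiantsHypothesis.ValiantsHypothesis.Theorems.LacunarySymmetroidMatrixDescartes.TropicalCensus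

open Summit.ValiantsHypothesis.ValiantsHypothesis.Theorems.LacunarySymmetroidMatrixDescartes
open scoped BigOperators
open Polynomial

namespace SupportSectors

/-- **the tropical floor, all formats**: `TropRootLawAt m K n → m·(K−1) ≤ n` (tree `DiagK.le_of_tropRootLawAt` for `K ≥ 2`;
trivial for `K ≤ 1`). [folklore] -/
theorem floor {m K n : ℕ} (hT : TropRootLawAt m K n) : m * (K - 1) ≤ n := by
  rcases Nat.lt_or_ge K 2 with hK | hK
  · have : K - 1 = 0 := by omega
    rw [this, Nat.mul_zero]
    exact Nat.zero_le _
  · exact DiagK.le_of_tropRootLawAt m K hK hT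

/-- the real zeros of `X^k · q` are among `0` and the real zeros of `q`: at most one more distinct zero. [folklore] -/
theorem card_roots_toFinset_X_pow_mul_le (k : ℕ) (q : ℝ[X]) :
    (((X : ℝ[X]) ^ k) * q).roots.toFinset.card ≤ q.roots.toFinset.card + 1 := by
  classical
  by_cases hq : q = 0
  · simp [hq]
  have hsub : (((X : ℝ[X]) ^ k) * q).roots.toFinset ⊆ insert 0 q.roots.toFinset := by
    intro x hx
    simp only [Multiset.mem_toFinset, mem_roots', IsRoot.def, eval_mul, eval_pow, eval_X, mul_eq_zero,
      Finset.mem_insert] at hx ⊢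
    rcases hx.2 with h | h
    · exact Or.inl (pow_eq_zero_iff'.1 h).1
    · exact Or.inr ⟨hq, h⟩
  exact (Finset.card_le_card hsub).trans (Finset.card_insert_le _ _)

/-- **fibres of `x ↦ x^g` have at most two real points**: for `g ≠ 0` the polynomial `p(X^g)` has at most twice as many distinct
real zeros as `p` (tree `lacunarySymmetroid_card_le_two_of_pow_eq`: one nonnegative and one negative point per fibre). [folklore] -/
theorem card_roots_toFinset_comp_X_pow_le (p : ℝ[X]) {g : ℕ} (hg : g ≠ 0) :
    (p.comp ((X : ℝ[X]) ^ g)).roots.toFinset.card ≤ 2 * p.roots.toFinset.card := by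
  classical
  by_cases hp0 : p = 0
  · simp [hp0]
  have hmaps : ∀ x ∈ (p.comp ((X : ℝ[X]) ^ g)).roots.toFinset, (fun y : ℝ => y ^ g) x ∈ p.roots.toFinset := by
    intro x hx
    simp only [Multiset.mem_toFinset, mem_roots', IsRoot.def, eval_comp, eval_pow, eval_X] at hx ⊢
    exact ⟨hp0, hx.2⟩
  have hfib : ∀ b ∈ p.roots.toFinset,
      ((p.comp ((X : ℝ[X]) ^ g)).roots.toFinset.filter (fun x : ℝ => (fun y : ℝ => y ^ g) x = b)).card ≤ 2 :=
    fun b _ => Theorems.lacunarySymmetroid_card_le_two_of_pow_eq hg _ b (fun x hx => (Finset.mem_filter.1 hx).2)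
  exact Finset.card_le_mul_card_image_of_maps_to hmaps 2 hfib

/-- **affine supports compress**: for `d l = a + g · e l` the pencil determinant is `(X^a)^m · q(X^g)` with `q` the determinant
of the compressed pencil on the support `e` (determinants commute with `Polynomial.compRingHom (X^g)` and with scalars). [folklore] -/
theorem det_pencil_affine {K m : ℕ} (a g : ℕ) (e : Fin K → ℕ) (S : Fin K → Matrix (Fin m) (Fin m) ℝ) :
    Matrix.det (∑ l, ((X : ℝ[X]) ^ (a + g * e l)) • (S l).map C)
      = ((X : ℝ[X]) ^ a) ^ m * (Matrix.det (∑ l, ((X : ℝ[X]) ^ e l) • (S l).map C)).comp ((X : ℝ[X]) ^ g) := by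
  have hmap : (Polynomial.compRingHom ((X : ℝ[X]) ^ g)).mapMatrix (∑ l, ((X : ℝ[X]) ^ e l) • (S l).map C)
      = ∑ l, (((X : ℝ[X]) ^ g) ^ e l) • (S l).map C := by
    ext i j
    simp only [RingHom.mapMatrix_apply, Matrix.map_apply, Matrix.sum_apply, Matrix.smul_apply, smul_eq_mul,
      coe_compRingHom_apply, map_sum, mul_comp, pow_comp, X_comp, C_comp]
  have hsum : (∑ l, ((X : ℝ[X]) ^ (a + g * e l)) • (S l).map C)
      = ((X : ℝ[X]) ^ a) • ∑ l, (((X : ℝ[X]) ^ g) ^ e l) • (S l).map C := by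
    rw [Finset.smul_sum]
    refine Finset.sum_congr rfl fun l _ => ?_
    rw [smul_smul, ← pow_mul, ← pow_add]
  rw [hsum, Matrix.det_smul, Fintype.card_fin, ← hmap, ← RingHom.map_det, Polynomial.coe_compRingHom_apply]

end SupportSectors

/-- **HEIGHT SECTOR (sharp form).**  If the tropical row `(m, K)` is at most `n` and the support has height `d l ≤ D·(K−1)` for all
`l`, then EVERY `K`-term `m × m` lacunary pencil on it (symmetric or not) has at most `D·(n+1)` distinct real zeros of its
determinant: `Z ≤ m·D(K−1)` by the degree ceiling and `m(K−1) ≤ n` by the tropical floor. [folklore] -/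
theorem card_roots_le_of_height (m K n D : ℕ) (hT : TropRootLawAt m K n) (d : Fin K → ℕ)
    (hD : ∀ l, d l ≤ D * (K - 1)) (S : Fin K → Matrix (Fin m) (Fin m) ℝ) :
    (Matrix.det (∑ l, ((X : ℝ[X]) ^ d l) • (S l).map C)).roots.toFinset.card ≤ D * (n + 1) := by
  have h1 := card_roots_det_pencil_le_degree d S (D * (K - 1)) hD
  have h2 := SupportSectors.floor hT
  calc (Matrix.det (∑ l, ((X : ℝ[X]) ^ d l) • (S l).map C)).roots.toFinset.card ≤ m * (D * (K - 1)) := h1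
    _ = D * (m * (K - 1)) := by ring
    _ ≤ D * n := Nat.mul_le_mul_left D h2
    _ ≤ D * (n + 1) := Nat.mul_le_mul_left D (Nat.le_succ n)

/-- **`Lifting` verbatim on the HEIGHT SECTOR** (constant `C`, every format, no symmetry needed): a tropical row bound `n` at
`(m, K)` gives `Z ≤ 2^{CK}·(n+1)` for every pencil on a support of height `≤ 2^{CK}·(K−1)`.  So `Lifting` with constant `C` can
only fail on supports of height exceeding `2^{CK}(K−1)`. [folklore] -/
theorem lifting_boundedHeight (c m K n : ℕ) (hT : TropRootLawAt m K n) (d : Fin K → ℕ)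
    (hD : ∀ l, d l ≤ 2 ^ (c * K) * (K - 1)) (S : Fin K → Matrix (Fin m) (Fin m) ℝ) :
    (Matrix.det (∑ l, ((X : ℝ[X]) ^ d l) • (S l).map C)).roots.toFinset.card ≤ 2 ^ (c * K) * (n + 1) :=
  card_roots_le_of_height m K n (2 ^ (c * K)) hT d hD S

/-- **AFFINE-IMAGE SECTOR (sharp form).**  If the tropical row `(m, K)` is at most `n` and the support is `d l = a + g·e l` with
`g ≥ 1` and `e l ≤ H·(K−1)` for all `l`, then every `K`-term `m × m` pencil on it has at most `(2H+1)·(n+1)` distinct real zeros: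
`Z ≤ 1 + 2·Z(e-pencil) ≤ 1 + 2mH(K−1) ≤ 1 + 2Hn`. [folklore] -/
theorem card_roots_affineSupport (m K n a g H : ℕ) (hg : 1 ≤ g) (hT : TropRootLawAt m K n) (e : Fin K → ℕ)
    (hH : ∀ l, e l ≤ H * (K - 1)) (S : Fin K → Matrix (Fin m) (Fin m) ℝ) :
    (Matrix.det (∑ l, ((X : ℝ[X]) ^ (a + g * e l)) • (S l).map C)).roots.toFinset.card ≤ (2 * H + 1) * (n + 1) := by
  rw [SupportSectors.det_pencil_affine, ← pow_mul]
  have h1 := SupportSectors.card_roots_toFinset_X_pow_mul_le (a * m)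
    ((Matrix.det (∑ l, ((X : ℝ[X]) ^ e l) • (S l).map C)).comp ((X : ℝ[X]) ^ g))
  have h2 := SupportSectors.card_roots_toFinset_comp_X_pow_le
    (Matrix.det (∑ l, ((X : ℝ[X]) ^ e l) • (S l).map C)) (g := g) (by omega)
  have h3 := card_roots_det_pencil_le_degree e S (H * (K - 1)) hH
  have h4 := SupportSectors.floor hT
  have h5 : m * (H * (K - 1)) = H * (m * (K - 1)) := by ring
  have h6 : H * (m * (K - 1)) ≤ H * n := Nat.mul_le_mul_left H h4
  nlinarith

/-- **`Lifting` verbatim on the AFFINE-IMAGE SECTOR** (constant `C`, every format): for supports `d = a + g·e`, `g ≥ 1`, with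
`e l ≤ H(K−1)` and `2H + 1 ≤ 2^{CK}`, a tropical row bound `n` gives `Z ≤ 2^{CK}·(n+1)`.  So `Lifting` (constant `C`) can only fail
on supports that are NOT affine images of supports of height `≤ (2^{CK−1} − 1)(K−1)`. [folklore] -/
theorem lifting_affineSupport (c m K n a g H : ℕ) (hg : 1 ≤ g) (hT : TropRootLawAt m K n) (e : Fin K → ℕ)
    (hH : ∀ l, e l ≤ H * (K - 1)) (hHC : 2 * H + 1 ≤ 2 ^ (c * K)) (S : Fin K → Matrix (Fin m) (Fin m) ℝ) :
    (Matrix.det (∑ l, ((X : ℝ[X]) ^ (a + g * e l)) • (S l).map C)).roots.toFinset.card ≤ 2 ^ (c * K) * (n + 1) :=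
  (card_roots_affineSupport m K n a g H hg hT e hH S).trans (Nat.mul_le_mul_right _ hHC)

/-- **`Lifting` on every ARITHMETIC-PROGRESSION support** (`d l = a + g·l`, any start, any gap `g ≥ 1`; sharp form `Z ≤ 3(n+1)`,
hence `C = 2`): the compressed support is `(0, 1, …, K−1)`, of height `K − 1`. [folklore] -/
theorem lifting_apSupport (m K n a g : ℕ) (hg : 1 ≤ g) (hT : TropRootLawAt m K n)
    (S : Fin K → Matrix (Fin m) (Fin m) ℝ) :
    (Matrix.det (∑ l : Fin K, ((X : ℝ[X]) ^ (a + g * (l : ℕ))) • (S l).map C)).roots.toFinset.card ≤ 3 * (n + 1) :=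
  card_roots_affineSupport m K n a g 1 hg hT (fun l => (l : ℕ)) (fun l => by have := l.isLt; omega) S

/-- the AP sector in `Lifting`'s shape with `C = 2` (for `K ≥ 1`; at `K = 0` the determinant is the constant `det 0` and has no
zero at all). [folklore] -/
theorem lifting_apSupport_pow (m K n a g : ℕ) (hg : 1 ≤ g) (hK : 1 ≤ K) (hT : TropRootLawAt m K n)
    (S : Fin K → Matrix (Fin m) (Fin m) ℝ) :
    (Matrix.det (∑ l : Fin K, ((X : ℝ[X]) ^ (a + g * (l : ℕ))) • (S l).map C)).roots.toFinset.card
      ≤ 2 ^ (2 * K) * (n + 1) := by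
  refine (lifting_apSupport m K n a g hg hT S).trans (Nat.mul_le_mul_right _ ?_)
  calc (3 : ℕ) ≤ 2 ^ (2 * 1) := by norm_num
    _ ≤ 2 ^ (2 * K) := Nat.pow_le_pow_right (by norm_num) (by omega)

/-- **LOW-RANK SECTOR (size-free, support-free real bound).**  If every letter except a pivot `l₀` has rank `< 2^c` (`c ≥ 1`),
then the determinant of the `K`-term `m × m` pencil has at most `2^{cK} − 1` distinct real zeros — for EVERY size and EVERY
support: positive zeros of the pencil and of its reflection `S l ↦ (−1)^{d l} S l` are each `< (2^c)^{K−1}` by the tree's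
`lowRankCeiling_uniform`, plus the origin (`stub_negRoots`). [folklore] -/
theorem card_roots_lowRank_le {K m : ℕ} (c : ℕ) (hc : 1 ≤ c) (l₀ : Fin K) (d : Fin K → ℕ)
    (S : Fin K → Matrix (Fin m) (Fin m) ℝ) (hr : ∀ l, l ≠ l₀ → (S l).rank < 2 ^ c) :
    (Matrix.det (∑ l, ((X : ℝ[X]) ^ d l) • (S l).map C)).roots.toFinset.card ≤ 2 ^ (c * K) - 1 := by
  have hr' : ∀ l, l ≠ l₀ → (((-1 : ℝ) ^ d l) • S l).rank < 2 ^ c :=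
    fun l hl => lt_of_le_of_lt (Literature.Computability.AlgebraicComplexity.rank_smul_le _ _) (hr l hl)
  obtain ⟨K', rfl⟩ : ∃ K', K = K' + 1 := ⟨K - 1, by have := Fin.pos l₀; omega⟩
  have h2c : 2 ^ c - 1 + 1 = 2 ^ c := Nat.sub_add_cancel Nat.one_le_two_pow
  have hA := lowRankCeiling_uniform l₀ (2 ^ c - 1) d S (fun l hl => Nat.le_sub_one_of_lt (hr l hl))
  have hB := lowRankCeiling_uniform l₀ (2 ^ c - 1) d (fun l => ((-1 : ℝ) ^ d l) • S l)
    (fun l hl => Nat.le_sub_one_of_lt (hr' l hl))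
  rw [h2c, Nat.add_sub_cancel] at hA hB
  have hZ := stub_negRoots (K' + 1) m d S
  set P : ℕ := (2 ^ c) ^ K' with hP
  have h2 : 2 ≤ 2 ^ c := by
    calc (2 : ℕ) = 2 ^ 1 := by norm_num
      _ ≤ 2 ^ c := Nat.pow_le_pow_right (by norm_num) hc
  have hpow : 2 ^ (c * (K' + 1)) = 2 ^ c * P := by
    rw [hP, pow_mul, pow_succ, mul_comm]
  have hPP : 2 * P ≤ 2 ^ c * P := Nat.mul_le_mul_right P h2
  rw [hpow]
  omega

/-- **`Lifting` verbatim on the LOW-RANK SECTOR** (constant `c ≥ 1`, every format, every support, NO tropical input needed): if all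
letters but one have rank `< 2^c` then `Z ≤ 2^{cK}·(n+1)` for every `n`; rank-one letters around one arbitrary letter give `C = 1`.
So a failure of `Lifting` (constant `C`) needs at least two letters of rank `≥ 2^C`. [folklore] -/
theorem lifting_lowRankSector {K m : ℕ} (c : ℕ) (hc : 1 ≤ c) (l₀ : Fin K) (d : Fin K → ℕ)
    (S : Fin K → Matrix (Fin m) (Fin m) ℝ) (hr : ∀ l, l ≠ l₀ → (S l).rank < 2 ^ c) (n : ℕ) :
    (Matrix.det (∑ l, ((X : ℝ[X]) ^ d l) • (S l).map C)).roots.toFinset.card ≤ 2 ^ (c * K) * (n + 1) :=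
  calc (Matrix.det (∑ l, ((X : ℝ[X]) ^ d l) • (S l).map C)).roots.toFinset.card ≤ 2 ^ (c * K) - 1 :=
      card_roots_lowRank_le c hc l₀ d S hr
    _ ≤ 2 ^ (c * K) := Nat.sub_le _ _
    _ ≤ 2 ^ (c * K) * (n + 1) := Nat.le_mul_of_pos_right _ (Nat.succ_pos n)

end Summit.ValiantsHypothesis.ValiantsHypothesis.Theorems.LacunarySymmetroidMatrixDescartes.TropicalCensus
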